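import Summits.MatrixMultiplication.OmegaCensus.SmallFormats.MatMul22nRankGF7Slack5Search
import HarnessLib

/-!
# ω-census family (a): replay of the slack-5 search certificate, CHECK B part 1 of 8 (classes `0 ≤ c < 18`)

Cell `pub-omega` (unit `pub-omega-tensor-g16`), topic `Summits/MatrixMultiplication/OmegaCensus` (sub-folder `SmallFormats`).
Framing (verbatim): lottery ticket; floor = certified bounds/negative ranges. HONEST FRAMING: machine-generated kernel replay
(`pub-omega-tensor-g16/code/gen5_runs.py`): `search5 c = true` for the classes `0 ≤ c < 18` (4456 search nodes in 4 `decide`s).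
Meaning (`search5_sound`, `MatMul22nRankGF7Slack5SearchSound`): no LP-tight point of slack 5 has one of these representatives as torus-0 column.
Nothing here is progress on `ω`.
-/

namespace Summit.MatrixMultiplication.OmegaCensus.SmallFormats

set_option Elab.async false

set_option maxRecDepth 100000 in
set_option maxHeartbeats 400000000 in
/-- Classes `0 ≤ c < 1` (1303 nodes). -/
theorem search5_ok_0_1 : ∀ c : Fin 656, 0 ≤ c.val → c.val < 1 → search5 c.val = true := by decide +kernel

set_option maxRecDepth 100000 in
set_option maxHeartbeats 400000000 in
/-- Classes `1 ≤ c < 16` (1379 nodes). -/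
theorem search5_ok_1_16 : ∀ c : Fin 656, 1 ≤ c.val → c.val < 16 → search5 c.val = true := by decide +kernel

set_option maxRecDepth 100000 in
set_option maxHeartbeats 400000000 in
/-- Classes `16 ≤ c < 17` (217 nodes). -/
theorem search5_ok_16_17 : ∀ c : Fin 656, 16 ≤ c.val → c.val < 17 → search5 c.val = true := by decide +kernel

set_option maxRecDepth 100000 in
set_option maxHeartbeats 400000000 in
/-- Classes `17 ≤ c < 18` (1557 nodes). -/
theorem search5_ok_17_18 : ∀ c : Fin 656, 17 ≤ c.val → c.val < 18 → search5 c.val = true := by decide +kernel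

/-- CHECK B for the classes `0 ≤ c < 18`. -/
theorem search5_run_1 : ∀ c : Fin 656, 0 ≤ c.val → c.val < 18 → search5 c.val = true := by
  intro c _hlo hhi
  by_cases h1 : c.val < 1
  · exact search5_ok_0_1 c (by omega) h1
  by_cases h16 : c.val < 16
  · exact search5_ok_1_16 c (by omega) h16
  by_cases h17 : c.val < 17
  · exact search5_ok_16_17 c (by omega) h17
  exact search5_ok_17_18 c (by omega) hhi

end Summit.MatrixMultiplication.OmegaCensus.SmallFormats
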